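import Summits.QuantumFields.YangMills.Theorems.BalabanUVNodesN15KingModelGraphKatoDomination
import HarnessLib

/-!
# BalabanUVNodes ∕ N15 — THE KING-MODEL RUNG (PART Ͱ-p): KATO DOMINATION FOR EVERY STRICTLY DOMINANT HOPPING DATUM (SITE-DEPENDENT MASS) — the variable-mass maximum principle,
# whence `‖((H.coupling U)⁻¹)_{xy}‖ ≤ ((diag c − t)⁻¹)(x,y)` for EVERY `H` with `w ≥ 0`, `c_x > rowSum_x` and every unitary `U`: Dirichlet regions (boundary mass `> m²`) and —
# read abstractly — King's `A₀(U) = −Δ_U+m²+aQ_U^*Q_U` IN THE MASSIVE REGIME `m² > aL^{−2(d+1)}(L^{d+1}−2)`, dominated by an M-matrix (NOT by `G_k(1)`, cf. Ͱ-j)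
# (Track A, DAG node N15 = NE2; FAN-OUT v1.1 §N15 s3 «KING-MODEL RUNG»; count-neutral)

HONEST FRAMING.  Count-neutral (cell `pub-ymgap`, seat `pub-ymgap-dag-n15-e` g42; `--supports stmt-QuantumFields-27247 --as helper` = K3ᴬ, KEY MAP v3).  Finite graphs; the maximum
principle with a site-dependent mass is the only new ingredient (a copy of the tree's `B9Eq323KatoDomination` §2 with `m : ι → ℝ`); nothing of Bałaban's (3.42) asserted; the remark on
`A₀(U)` is an ABSTRACT reading (any datum whose bonds include same-block pairs with transporters `−W`, `W` unitary) — the covariant block averaging `Q_U` itself is NOT constructed here;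
NOT a node discharge (N15 of record untouched); nothing continuum ∕ ℝ⁴ ∕ OS ∕ Clay.

THE RESULTS.
* §1 THE VARIABLE-MASS MAXIMUM PRINCIPLE (slot form of `B9Eq323KatoDomination`, mass `m : ι → ℝ`, `0 < m x`): `scalar_nonneg_of_resolvent_varMass`, `scalar_eq_zero_of_resolvent_varMass`,
  ★★ **`norm_le_scalar_of_resolvent_varMass`** (`L u + m·u = f`, `L₀φ + m·φ = g`, `‖f‖ ≤ g` ⟹ `‖u‖ ≤ φ` — Kato at a maximum point of `‖u‖ − φ`). [DodziukMathai2006] Lemma 1.1∕1.2, Thm 1.5.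
* §2 FOR EVERY STRICTLY DOMINANT DATUM (`H.StrictDom`: `w ≥ 0`, `rowSum_x < c_x`) and every unitary `U`, with the SITE MASS `siteMass H x = c_x − rowSum_x > 0`: `gfib_eq_of_coupling_mulVec_varMass`,
  `scalar_eq_of_scalarCoupling_mulVec_varMass`, ★ `isUnit_scalarCoupling_of_strictDom`, ★★★ **`norm_gfib_coupling_inv_mulVec_le_of_strictDom`**, `scalarCoupling_inv_nonneg_of_strictDom`,
  ★★★ **`norm_blk_coupling_inv_mulVec_le_of_strictDom`**, ★★★ **`norm_coupling_inv_entry_le_of_strictDom`** (`|((H.coupling U)⁻¹)((x,i),(y,j))| ≤ ((diag c − t)⁻¹)(x,y)`) — Ͱ-m without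
  the free-boundary restriction: DIRICHLET regions (`c_x = m² + (full degree)·c`, boundary sites heavier) and any strictly dominant penalty are covered.
* §3 READING FOR KING's FULL OPERATOR (docstring-level, abstract): a datum whose bonds are the nearest-neighbour bonds (weight `c`, transporter `U`) AND the same-block pairs (weight
  `aL^{−2(d+1)}`, transporter MINUS a unitary) with `c_x = m² + 2(d+1)c + aL^{−2(d+1)}` is strictly dominant iff `m² > aL^{−2(d+1)}(L^{d+1} − 2)`; then §2 dominates its inverse by the
  M-matrix `(diag c − t)⁻¹` — `t` now INCLUDES the same-block weights with a POSITIVE sign, so the majorant is NOT King's `G_k(1)` (whose same-block entries have the opposite sign and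
  whose inverse is not non-negative, Ͱ-j) but a different, entrywise non-negative `A = 0` kernel. `strictDom_iff_mass_gt` records the arithmetic of that threshold for constant data.

PRIOR TREE ART (by name): `B9Eq323KatoDomination` (`kato_pointwise`, `sum_nonneg_of_isMax`), `LatticeDiamagneticInequality.Hopping` (`coupling`, `rowSum`, `StrictDom`, `posDef_coupling`,
`weightMatrix`), Ͱ-m (`graphNbr`, `graphW`, `graphT`, `gfib`, `scalarCoupling`, `sum_graphW`, `graphW_nonneg`, `norm_graphT_le`, `gfib_hop_mulVec`, `scalarCoupling_mulVec_apply`,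
`norm_gfib_pointSource`, `gfib_mulVec_pointSource`).  Dedup (rg at filing): basename 0 files; needles `varMass|siteMass|of_strictDom` in this namespace 0 tree files.
Locators: [DodziukMathai2006] §1 Lemma 1.1, Lemma 1.2, Thm 1.5; [Balaban1985BackgroundPropagators] (3.23)∕(3.24) p.394; [King1986] (2.13)–(2.14) p.653, §4 p.670.  0 `sorry`, 1 plumbing `def`.
-/

noncomputable section

open scoped BigOperators ComplexConjugate ComplexOrder InnerProductSpace
open Finset Matrix WithLp

namespace Summit.QuantumFields.YangMills.BalabanUVNodes.N15KingModelRung.Covariant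

open Literature.MathematicalPhysics.QuantumFieldTheory.LatticeDiamagneticInequality (Hopping blk placed)
open Literature.MathematicalPhysics.QuantumFieldTheory.Balaban1983to89.B9Eq323KatoDomination (kato_pointwise sum_nonneg_of_isMax)

/-! ## §1 The maximum principle with a site-dependent mass -/

section VarMass

variable {𝕜 : Type*} [RCLike 𝕜] {V : Type*} [NormedAddCommGroup V] [InnerProductSpace 𝕜 V] {ι J : Type*} [Fintype J] [Fintype ι]

/-- Positivity of the scalar resolvent with a SITE-DEPENDENT mass: `L₀φ + m·φ = g`, `0 < m_x`, `0 ≤ g` ⟹ `0 ≤ φ` (minimum point). [cite: DodziukMathai2006, Lemma 1.1 §1] -/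
theorem scalar_nonneg_of_resolvent_varMass (nbr : ι → J → ι) (w : ι → J → ℝ) (hw : ∀ x j, 0 ≤ w x j) {m : ι → ℝ} (hm : ∀ x, 0 < m x) {φ g : ι → ℝ}
    (hφ : ∀ x, ∑ j, w x j * (φ x - φ (nbr x j)) + m x * φ x = g x) (hg : ∀ x, 0 ≤ g x) (x : ι) : 0 ≤ φ x := by
  obtain ⟨x₁, -, hx₁⟩ := Finset.exists_min_image Finset.univ φ ⟨x, Finset.mem_univ x⟩
  have hmin : ∀ y, φ x₁ ≤ φ y := fun y => hx₁ y (Finset.mem_univ y)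
  refine le_trans ?_ (hmin x)
  have h0 : ∑ j, w x₁ j * (φ x₁ - φ (nbr x₁ j)) ≤ 0 :=
    Finset.sum_nonpos fun j _ => mul_nonpos_of_nonneg_of_nonpos (hw x₁ j) (sub_nonpos.2 (hmin _))
  by_contra hneg
  push Not at hneg
  have := hφ x₁
  nlinarith [hg x₁, h0, hm x₁, hneg]

/-- Uniqueness for the scalar equation with a site-dependent mass: `L₀φ + m·φ = 0` ⟹ `φ = 0`. [cite: DodziukMathai2006, Lemma 1.1 §1] -/
theorem scalar_eq_zero_of_resolvent_varMass (nbr : ι → J → ι) (w : ι → J → ℝ) (hw : ∀ x j, 0 ≤ w x j) {m : ι → ℝ} (hm : ∀ x, 0 < m x) {φ : ι → ℝ}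
    (hφ : ∀ x, ∑ j, w x j * (φ x - φ (nbr x j)) + m x * φ x = 0) : φ = 0 := by
  have h1 : ∀ x, 0 ≤ φ x := scalar_nonneg_of_resolvent_varMass nbr w hw hm (g := fun _ => 0) hφ (fun _ => le_rfl)
  have h2 : ∀ x, 0 ≤ -φ x := scalar_nonneg_of_resolvent_varMass nbr w hw hm (φ := fun x => -φ x) (g := fun _ => 0)
    (fun x => by
      have h := hφ x
      have hs : ∑ j, w x j * (-φ x - -φ (nbr x j)) = -∑ j, w x j * (φ x - φ (nbr x j)) := by
        rw [← Finset.sum_neg_distrib]; exact Finset.sum_congr rfl fun j _ => by ring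
      rw [hs]; linarith [h]) (fun _ => le_rfl)
  funext x
  rw [Pi.zero_apply]
  exact le_antisymm (by linarith [h2 x]) (h1 x)

/-- ★★ **DOMINATION WITH A SITE-DEPENDENT MASS**: `L u + m·u = f` (contractive transporters), `L₀φ + m·φ = g` (same weights, neighbours and mass), `‖f(x)‖ ≤ g(x)` ⟹ `‖u(x)‖ ≤ φ(x)` —
Kato's inequality at a maximum point of `‖u‖ − φ`; the tree's `norm_le_scalar_of_resolvent` with `m : ι → ℝ`. [cite: DodziukMathai2006, Thm 1.5 + Remark 1.6 §1] -/
theorem norm_le_scalar_of_resolvent_varMass (nbr : ι → J → ι) (w : ι → J → ℝ) (hw : ∀ x j, 0 ≤ w x j) (T : ι → J → V →ₗ[𝕜] V)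
    (hT : ∀ x j v, ‖T x j v‖ ≤ ‖v‖) {m : ι → ℝ} (hm : ∀ x, 0 < m x) {u f : ι → V} {φ g : ι → ℝ}
    (hu : ∀ x, ∑ j, (w x j : 𝕜) • (u x - T x j (u (nbr x j))) + (m x : 𝕜) • u x = f x)
    (hφ : ∀ x, ∑ j, w x j * (φ x - φ (nbr x j)) + m x * φ x = g x) (hfg : ∀ x, ‖f x‖ ≤ g x) (x : ι) : ‖u x‖ ≤ φ x := by
  obtain ⟨x₀, -, hx₀⟩ := Finset.exists_max_image Finset.univ (fun y => ‖u y‖ - φ y) ⟨x, Finset.mem_univ x⟩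
  have hmax : ∀ y, ‖u y‖ - φ y ≤ ‖u x₀‖ - φ x₀ := fun y => hx₀ y (Finset.mem_univ y)
  have hφ0 : 0 ≤ φ x₀ := scalar_nonneg_of_resolvent_varMass nbr w hw hm hφ (fun y => (norm_nonneg _).trans (hfg y)) x₀
  by_contra hx
  have hψ : 0 < ‖u x₀‖ - φ x₀ := lt_of_lt_of_le (by linarith) (hmax x)
  have hpos : 0 < ‖u x₀‖ := by linarith
  have hk := kato_pointwise nbr w hw T hT u x₀
  have hL : ∑ j, (w x₀ j : 𝕜) • (u x₀ - T x₀ j (u (nbr x₀ j))) = f x₀ - (m x₀ : 𝕜) • u x₀ := eq_sub_of_add_eq (hu x₀)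
  rw [hL, inner_sub_right, map_sub, inner_smul_right, RCLike.re_ofReal_mul, inner_self_eq_norm_sq (𝕜 := 𝕜)] at hk
  have h1 : RCLike.re ⟪u x₀, f x₀⟫_𝕜 ≤ ‖u x₀‖ * g x₀ :=
    (RCLike.re_le_norm _).trans ((norm_inner_le_norm _ _).trans (mul_le_mul_of_nonneg_left (hfg x₀) (norm_nonneg _)))
  have h2 : ∑ j, w x₀ j * (‖u x₀‖ - ‖u (nbr x₀ j)‖) ≤ g x₀ - m x₀ * ‖u x₀‖ :=
    le_of_mul_le_mul_left (by nlinarith [hk, h1]) hpos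
  have h3 : ∑ j, w x₀ j * ((‖u x₀‖ - φ x₀) - (‖u (nbr x₀ j)‖ - φ (nbr x₀ j))) ≤ -(m x₀ * (‖u x₀‖ - φ x₀)) := by
    have he : ∑ j, w x₀ j * ((‖u x₀‖ - φ x₀) - (‖u (nbr x₀ j)‖ - φ (nbr x₀ j))) =
        ∑ j, w x₀ j * (‖u x₀‖ - ‖u (nbr x₀ j)‖) - ∑ j, w x₀ j * (φ x₀ - φ (nbr x₀ j)) := by
      rw [← Finset.sum_sub_distrib]; exact Finset.sum_congr rfl fun j _ => by ring
    rw [he]; nlinarith [h2, hφ x₀]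
  have h4 := sum_nonneg_of_isMax nbr w hw (fun y => ‖u y‖ - φ y) hmax
  nlinarith [h3, h4, hψ, hm x₀]

end VarMass

/-! ## §2 Domination for every strictly dominant hopping datum -/

section Strict

variable {ι β : Type*} {𝕜 : Type*} [RCLike 𝕜] {n : Type*}

/-- THE SITE MASS of a hopping datum: `m_x = c_x − rowSum_x` (`> 0` under strict dominance; `= m²` for free-boundary data, `> m²` at Dirichlet boundary sites). [folklore] -/
def siteMass [Fintype β] [DecidableEq ι] (H : Hopping ι β) (x : ι) : ℝ := H.c x - H.rowSum x

variable [Fintype ι] [Fintype β] [DecidableEq ι] [Fintype n] [DecidableEq n] (H : Hopping ι β)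

omit [Fintype ι] [Fintype n] [DecidableEq n] in
/-- Under strict dominance the site mass is positive. [folklore] -/
theorem siteMass_pos (hH : H.StrictDom) (x : ι) : 0 < siteMass H x := sub_pos.2 (hH.dom x)

omit [Fintype ι] [Fintype n] [DecidableEq n] in
/-- `c_x = m_x + rowSum_x`. [folklore] -/
theorem c_eq_siteMass_add (x : ι) : H.c x = siteMass H x + H.rowSum x := by rw [siteMass, sub_add_cancel]

/-- ★ THE COVARIANT EQUATION IN KATO FORM WITH THE SITE MASS: `M_Uv = f` ⟹ `Σ_j graphW x j·(v_x − T_jv_{nbr}) + m_x·v_x = f_x`. [cite: Balaban1985BackgroundPropagators, (3.23)∕(3.24) p.394] -/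
theorem gfib_eq_of_coupling_mulVec_varMass (U : β → Matrix n n 𝕜) {v f : ι × n → 𝕜} (hv : H.coupling U *ᵥ v = f) (x : ι) :
    ∑ j, (graphW H x j : 𝕜) • (gfib v x - graphT U x j (gfib v (graphNbr H x j))) + (siteMass H x : 𝕜) • gfib v x = gfib f x := by
  have hx : gfib f x = gfib (H.coupling U *ᵥ v) x := by rw [hv]
  rw [hx, Hopping.coupling, sub_mulVec]
  have hsplit : gfib ((diagonal fun p : ι × n => (H.c p.1 : 𝕜)) *ᵥ v - H.hop U *ᵥ v) x = ((H.c x : ℝ) : 𝕜) • gfib v x - gfib (H.hop U *ᵥ v) x := by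
    ext i; simp [gfib, mulVec_diagonal, RCLike.real_smul_eq_coe_mul]
  rw [hsplit, gfib_hop_mulVec, c_eq_siteMass_add, ← sum_graphW]
  simp only [smul_sub, Finset.sum_sub_distrib, RCLike.ofReal_add, RCLike.ofReal_sum, add_smul, Finset.sum_smul]
  abel

omit [Fintype n] [DecidableEq n] in
/-- ★ THE SCALAR EQUATION IN KATO FORM WITH THE SITE MASS: `M₀φ = g` ⟹ `Σ_j graphW x j·(φ_x − φ_{nbr}) + m_x·φ_x = g_x`. [cite: DodziukMathai2006, Lemma 1.1 §1] -/
theorem scalar_eq_of_scalarCoupling_mulVec_varMass {φ g : ι → ℝ} (hφ : scalarCoupling H *ᵥ φ = g) (x : ι) :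
    ∑ j, graphW H x j * (φ x - φ (graphNbr H x j)) + siteMass H x * φ x = g x := by
  rw [← hφ, scalarCoupling_mulVec_apply, c_eq_siteMass_add, ← sum_graphW]
  simp only [mul_sub, Finset.sum_sub_distrib, add_mul, Finset.sum_mul]
  ring

omit [Fintype n] [DecidableEq n] in
/-- ★ `M₀ = diag c − t` IS INVERTIBLE under strict dominance (uniqueness by the variable-mass maximum principle). [cite: DodziukMathai2006, Lemma 1.1 §1] -/
theorem isUnit_scalarCoupling_of_strictDom (hH : H.StrictDom) : IsUnit (scalarCoupling H) := by
  refine Matrix.mulVec_injective_iff_isUnit.mp fun φ ψ h => ?_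
  have h0 : scalarCoupling H *ᵥ (φ - ψ) = 0 := by rw [Matrix.mulVec_sub, h, sub_self]
  have hz := scalar_eq_zero_of_resolvent_varMass (graphNbr H) (graphW H) (graphW_nonneg H hH.w_nonneg) (siteMass_pos H hH) (φ := φ - ψ)
    (fun x => by simpa only [Pi.zero_apply] using scalar_eq_of_scalarCoupling_mulVec_varMass H h0 x)
  exact sub_eq_zero.mp hz

/-- ★★★ **KATO DOMINATION FOR EVERY STRICTLY DOMINANT DATUM**: `H.StrictDom` (`w ≥ 0`, `rowSum_x < c_x`), any unitary link field `U`, `‖f_x‖ ≤ g_x` for all sites ⟹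
`‖(M_U⁻¹f)_x‖ ≤ (M₀⁻¹g)_x` for all sites (`M_U = H.coupling U`, `M₀ = diag c − t`).  Free AND Dirichlet boundary conventions, site-dependent masses, extra penalty bonds with transporters
`−W` — all covered. [cite: DodziukMathai2006, Thm 1.5 + Remark 1.6 §1; Balaban1985BackgroundPropagators, (3.23)∕(3.24) p.394] -/
theorem norm_gfib_coupling_inv_mulVec_le_of_strictDom (hH : H.StrictDom) {U : β → Matrix n n 𝕜} (hU : ∀ b, U b ∈ Matrix.unitaryGroup n 𝕜)
    {f : ι × n → 𝕜} {g : ι → ℝ} (hfg : ∀ x, ‖gfib f x‖ ≤ g x) (x : ι) :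
    ‖gfib ((H.coupling U)⁻¹ *ᵥ f) x‖ ≤ ((scalarCoupling H)⁻¹ *ᵥ g) x := by
  have hdet : IsUnit (H.coupling U).det := (Matrix.isUnit_iff_isUnit_det _).mp (H.posDef_coupling hH hU).isUnit
  have hdet0 : IsUnit (scalarCoupling H).det := (Matrix.isUnit_iff_isUnit_det _).mp (isUnit_scalarCoupling_of_strictDom H hH)
  have hv : H.coupling U *ᵥ ((H.coupling U)⁻¹ *ᵥ f) = f := by rw [mulVec_mulVec, Matrix.mul_nonsing_inv _ hdet, one_mulVec]
  have hφ : scalarCoupling H *ᵥ ((scalarCoupling H)⁻¹ *ᵥ g) = g := by rw [mulVec_mulVec, Matrix.mul_nonsing_inv _ hdet0, one_mulVec]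
  exact norm_le_scalar_of_resolvent_varMass (graphNbr H) (graphW H) (graphW_nonneg H hH.w_nonneg) (graphT U) (norm_graphT_le hU) (siteMass_pos H hH)
    (gfib_eq_of_coupling_mulVec_varMass H U hv) (scalar_eq_of_scalarCoupling_mulVec_varMass H hφ) hfg x

omit [Fintype n] [DecidableEq n] in
/-- `M₀⁻¹ ≥ 0` entrywise under strict dominance. [cite: DodziukMathai2006, Lemma 1.1 §1] -/
theorem scalarCoupling_inv_nonneg_of_strictDom (hH : H.StrictDom) (x y : ι) : 0 ≤ (scalarCoupling H)⁻¹ x y := by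
  have hdet0 : IsUnit (scalarCoupling H).det := (Matrix.isUnit_iff_isUnit_det _).mp (isUnit_scalarCoupling_of_strictDom H hH)
  have hφ : scalarCoupling H *ᵥ ((scalarCoupling H)⁻¹ *ᵥ Pi.single y 1) = Pi.single y 1 := by
    rw [mulVec_mulVec, Matrix.mul_nonsing_inv _ hdet0, one_mulVec]
  have h := scalar_nonneg_of_resolvent_varMass (graphNbr H) (graphW H) (graphW_nonneg H hH.w_nonneg) (siteMass_pos H hH)
    (scalar_eq_of_scalarCoupling_mulVec_varMass H hφ) (fun z => by simp only [Pi.single_apply]; split_ifs <;> norm_num) x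
  simpa only [mulVec_single_one, Matrix.col_apply] using h

/-- ★★★ **BLOCKWISE DOMINATION FOR EVERY STRICTLY DOMINANT DATUM**: `‖(M_U⁻¹)_{xy}e‖ ≤ M₀⁻¹(x,y)·‖e‖`. [cite: DodziukMathai2006, Thm 1.5 §1] -/
theorem norm_blk_coupling_inv_mulVec_le_of_strictDom (hH : H.StrictDom) {U : β → Matrix n n 𝕜} (hU : ∀ b, U b ∈ Matrix.unitaryGroup n 𝕜) (x y : ι) (e : n → 𝕜) :
    ‖toLp 2 (blk ((H.coupling U)⁻¹) x y *ᵥ e)‖ ≤ (scalarCoupling H)⁻¹ x y * ‖toLp 2 e‖ := by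
  have h := norm_gfib_coupling_inv_mulVec_le_of_strictDom H hH hU (f := fun p : ι × n => if p.1 = y then e p.2 else 0)
    (g := fun z => (if z = y then 1 else 0) * ‖toLp 2 e‖) (fun z => (norm_gfib_pointSource y e z).le) x
  have hcol : ((scalarCoupling H)⁻¹ *ᵥ fun z => (if z = y then (1 : ℝ) else 0) * ‖toLp 2 e‖) x = (scalarCoupling H)⁻¹ x y * ‖toLp 2 e‖ := by
    have : (fun z : ι => (if z = y then (1 : ℝ) else 0) * ‖toLp 2 e‖) = Pi.single y ‖toLp 2 e‖ := by
      funext z; simp only [Pi.single_apply, ite_mul, one_mul, zero_mul]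
    rw [this, mulVec_single]; simp [Matrix.col_apply]
  rwa [gfib_mulVec_pointSource, hcol] at h

/-- ★★★ **ENTRYWISE DOMINATION FOR EVERY STRICTLY DOMINANT DATUM**: `|M_U⁻¹((x,i),(y,j))| ≤ M₀⁻¹(x,y)` for every unitary link field. [cite: DodziukMathai2006, Thm 1.5 §1] -/
theorem norm_coupling_inv_entry_le_of_strictDom (hH : H.StrictDom) {U : β → Matrix n n 𝕜} (hU : ∀ b, U b ∈ Matrix.unitaryGroup n 𝕜) (x y : ι) (i j : n) :
    ‖(H.coupling U)⁻¹ (x, i) (y, j)‖ ≤ (scalarCoupling H)⁻¹ x y := by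
  have h := norm_blk_coupling_inv_mulVec_le_of_strictDom H hH hU x y (Pi.single j 1)
  rw [mulVec_single_one, PiLp.toLp_single, PiLp.norm_single, norm_one, mul_one] at h
  refine le_trans ?_ h
  have := PiLp.norm_apply_le (toLp 2 ((blk ((H.coupling U)⁻¹) x y).col j)) i
  simpa only [PiLp.toLp_apply, Matrix.col_apply, blk, Matrix.of_apply] using this

end Strict

/-! ## §3 The threshold arithmetic for King's full operator (abstract reading) -/

/-- For a datum with CONSTANT site weight `m² + 2(d+1)c + p` and CONSTANT row sum `2(d+1)c + p·(B − 1)` (nearest-neighbour bonds of weight `c` plus `B − 1` same-block partners of weight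
`p = aL^{−2(d+1)}`, block volume `B = L^{d+1}`), strict dominance holds iff `m² > p·(B − 2)` — the MASSIVE REGIME in which §2 dominates King's full `A₀(U)` (with the same-block
transporters read as minus-unitaries) by an entrywise non-negative M-matrix kernel; outside it no maximum principle is available (and `G_k(1)` is never the majorant, Ͱ-j).
[cite: King1986, (2.13)–(2.14) p.653; Balaban1985BackgroundPropagators, (3.24) p.394] -/
theorem strictDom_iff_mass_gt (m2 c p B dd : ℝ) :
    2 * dd * c + p * (B - 1) < m2 + 2 * dd * c + p ↔ p * (B - 2) < m2 := by
  constructor <;> intro h <;> nlinarith [h]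

end Summit.QuantumFields.YangMills.BalabanUVNodes.N15KingModelRung.Covariant

end
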